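import Literature.NumberTheory.LFunctions.ZetaZeroSumsPsiErrorJohnstonYangVariants
import Literature.NumberTheory.LFunctions.ZetaZeroFreeRegionBellottiTrudgianYang
import HarnessLib

/-!
# RH-FREE — Johnston–Yang 2023, eq. (3.7) with a general classical zero-free-region constant `R ∈ [4, R₀]`, and the instance `R > 4.896` of Bellotti–Trudgian–Yang («nothing here bears on the truth of RH»)

Topic `Literature/NumberTheory/LFunctions` (RH literature-typing tranche 1, L4 "explicit zero
statistics", gen 10). Label **RH-FREE**. THEOREMS only (no definitions, no new named facts). Nothing
here bears on the truth of RH.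

`ZetaZeroSumsPsiErrorJohnstonYang.lean` proves Johnston–Yang's pointwise bound (3.7)
(J. Math. Anal. Appl. 527 (2023) 127460, §3.2)

  `|ψ(x) − x|/x ≤ s₁(x,σ;T) + s₂(x,σ,K;R) + s₃(x;T)`,  `T = exp(2√(log x/R))`,

for a GENERAL zero-free-region constant `R` (`JohnstonYang2023_eq37_of`, the zero-free region and
the four side conditions of Lemma 2.4 — `50 < T/1.8`, `log x < T/1.8`, `T/1.8 < (x^{1/35} − 2)/4` —
and `T ≥ H` being hypotheses), and instantiates it at the printed `R₀ = 5.5666305` for `x ≥ e^{2488}`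
(`JY2023.lemma24_conditions`, `JohnstonYang2023_eq37`). Here the side conditions are discharged for
EVERY `R ∈ [4, R₀]` and `x ≥ e^{2488}` (`JY2023.lemma24_conditions_of_le_R₀`: with `u = √(log x/R)`,
`u ≥ 21`, `T = e^{2u} ≥ 2^{42}`, `log x = Ru² < e^{2u}/1.8` by `e^{2u} ≥ (2u)⁴/4!`, and
`e·T = e^{2u+1} ≤ e^{4u²/35} ≤ x^{1/35}`), which gives:

* `JohnstonYang2023_eq37_of_zfr` — **(3.7) for any `R ∈ [4, R₀]` for which the closed classical
  region `σ ≥ 1 − 1/(R log|t|)`, `|t| ≥ 2`, is free of zeros** (hypothesis `hZFR`, literally the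
  shape used by `FKS2023.zfrHeight_lt_im` / `FioriKadiriSwidinsky2023_eq41'`), every Table-3 row
  `(σ, C₁, C₂)`, `K ≥ 1`, `x ≥ e^{2488}`; remaining named facts: `JohnstonYang2023_lemma24`,
  `platt_trudgian_numerical_rh`, `JohnstonYang2023_table3` (Brent–Platt–Trudgian's Lemma 8 is the
  tree's theorem `BrentPlattTrudgian2022_lemma8_holds`);
* `JohnstonYang2023_eq37_bty` — the instance **`4.896 < R ≤ R₀`** from the CLAIMED Theorem 1 of
  Bellotti–Trudgian–Yang 2026 (`zero_free_region_bellotti_trudgian_yang`, preprint, via `.zeroFree`),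
  the `ψ`-side companion of `FioriKadiriSwidinsky2023_eq41_of_bty_bw` (`ZetaZeroSumsPsiErrorInputs2026.lean`);
* `JohnstonYang2023_eq37_of_fks_table6_zfr` / `…_fks_table6_bty` — the same with the zero-density
  input read off Fiori–Kadiri–Swidinsky's Cor. 2.9 table (`FioriKadiriSwidinsky2023_table6`, closed
  count at `σ ∈ [0.90, 1)`), as in `JohnstonYang2023_eq37_of_fks_table6`;
(At `R = R₀` the general statement is literally the printed one, `JohnstonYang2023_eq37'` of
`ZetaZeroSumsPsiErrorJohnstonYangVariants.lean` — not restated here.)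

A smaller `R` enlarges `T = exp(2√(log x/R))`, so `s₃ = 4.3128 log^{0.6}x/T` and the weights
`x^{−1/(R log t_k)}/t_k` of `s₂` decrease while `log²(T/2π)` in `s₁` grows; no numerical value of
JY's Table 1 is re-derived here (the zero-density constants `C₁(σ), C₂(σ)` of Table 3 were computed
with `R₀` and are kept — they remain valid upper bounds). NOT a printed statement for `R ≠ R₀` — a
kernel consequence combining two typed sources ("TODO(general form)": the printed (3.7) is
`JohnstonYang2023_eq37`).

## References

* D. R. Johnston, A. Yang, J. Math. Anal. Appl. 527 (2023) 127460 = arXiv:2204.01980v2, Lemma 2.4,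
  §3.2 eqs. (3.2)–(3.8). [JohnstonYang2023]
* C. Bellotti, T. Trudgian, A. Yang, arXiv:2603.21490v1 (2026), Thm. 1 (`R = 4.896`, claimed).
  [BellottiTrudgianYang2026]
* A. Fiori, H. Kadiri, J. Swidinsky, J. Math. Anal. Appl. 527 (2023) 127426, Cor. 2.9.
  [FioriKadiriSwidinsky2023]
* R. P. Brent, D. J. Platt, T. S. Trudgian, J. Number Theory 238 (2022) 740–762, Lemma 8.
  [BrentPlattTrudgian2022]
-/

noncomputable section

open Complex Filter Set
open scoped Real Chebyshev Topology

namespace Literature.NumberTheory.LFunctions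

open SchoenfeldBound

/-! ## The side conditions of Lemma 2.4 for `R ∈ [4, R₀]` -/

/-- **The side conditions at `x ≥ e^{2488}` for every `R ∈ [4, R₀]`**: with `T = exp(2√(log x/R))`,
`50 < T/1.8`, `log x < T/1.8`, `T/1.8 < (x^{1/35} − 2)/4` and `H = 3 000 175 332 800 ≤ T`
(`u = √(log x/R) ≥ 21` as `R u² = log x ≥ 2488` and `R ≤ 5.5666305`; `T = e^{2u} ≥ 2^{42}`;
`Ru² · 1.8 < (2u)⁴/4! ≤ e^{2u}`; `2u + 1 ≤ 4u²/35 ≤ Ru²/35` as `R ≥ 4`, so `e·T ≤ x^{1/35}`).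
[cite: JohnstonYang2023, Lemma 2.4 and §3.2 (after eq. (3.3))] -/
theorem JY2023.lemma24_conditions_of_le_R₀ {R x : ℝ} (hR4 : 4 ≤ R) (hR : R ≤ JY2023.R₀)
    (hx : Real.exp 2488 ≤ x) :
    50 < JY2023.T R x / 1.8 ∧ Real.log x < JY2023.T R x / 1.8 ∧
      JY2023.T R x / 1.8 < (x ^ (1 / 35 : ℝ) - 2) / 4 ∧ JY2023.H₀ ≤ JY2023.T R x := by
  have hR₀ : JY2023.R₀ = 5.5666305 := rfl
  have hH : JY2023.H₀ = 3000175332800 := rfl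
  rw [hR₀] at hR
  have hR0 : 0 < R := by linarith
  have hx0 : 0 < x := (Real.exp_pos _).trans_le hx
  set L := Real.log x with hL
  have hL2488 : 2488 ≤ L := by
    rw [hL, ← Real.log_exp 2488]; exact Real.log_le_log (Real.exp_pos _) hx
  set u := Real.sqrt (L / R) with hu
  have hu0 : 0 ≤ u := Real.sqrt_nonneg _
  have hLu : L = R * u ^ 2 := by
    rw [hu, Real.sq_sqrt (div_nonneg (by linarith) hR0.le)]; field_simp
  have hu21 : 21 ≤ u := by
    by_contra h
    push Not at h
    have hu2 : u ^ 2 < 441 := by nlinarith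
    have : R * u ^ 2 < 5.5666305 * 441 := by nlinarith
    linarith
  have hT : JY2023.T R x = Real.exp (2 * u) := rfl
  -- `T ≥ e^{42} ≥ 2^{42}`
  have he2 : (2 : ℝ) ≤ Real.exp 1 := by have := Real.add_one_le_exp (1 : ℝ); norm_num at this; linarith
  have hT42 : (2 : ℝ) ^ 42 ≤ JY2023.T R x := by
    rw [hT]
    calc (2 : ℝ) ^ 42 ≤ Real.exp 1 ^ 42 := by gcongr
      _ = Real.exp 42 := by rw [← Real.exp_nat_mul]; norm_num
      _ ≤ Real.exp (2 * u) := Real.exp_le_exp.2 (by linarith)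
  have hTpos : 0 < JY2023.T R x := Real.exp_pos _
  refine ⟨?_, ?_, ?_, ?_⟩
  · rw [lt_div_iff₀ (by norm_num)]
    linarith [show (90 : ℝ) < 2 ^ 42 by norm_num]
  · -- `log x = Ru² < e^{2u}/1.8` since `e^{2u} ≥ (2u)⁴/24`
    rw [lt_div_iff₀ (by norm_num), hT]
    have h4 := Real.pow_div_factorial_le_exp (2 * u) (by linarith) 4
    have hfac : ((Nat.factorial 4 : ℕ) : ℝ) = 24 := by norm_num [Nat.factorial]
    rw [hfac] at h4
    rw [hLu]
    have hu2 : 441 ≤ u ^ 2 := by nlinarith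
    nlinarith [mul_le_mul_of_nonneg_left hu2 (sq_nonneg u)]
  · -- `x^{1/35} = e^{L/35} ≥ e^{2u+1} = e·T`
    have hx35 : x ^ (1 / 35 : ℝ) = Real.exp (L / 35) := by
      rw [Real.rpow_def_of_pos hx0, hL]; ring_nf
    have hexp : Real.exp (2 * u + 1) ≤ Real.exp (L / 35) := by
      refine Real.exp_le_exp.2 ?_
      rw [hLu]
      have h1 : 4 * u ^ 2 ≤ R * u ^ 2 := mul_le_mul_of_nonneg_right hR4 (sq_nonneg u)
      nlinarith [mul_nonneg (sub_nonneg.2 hu21) hu0]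
    rw [Real.exp_add, ← hT] at hexp
    have he27 : 2.7182818283 < Real.exp 1 := Real.exp_one_gt_d9
    rw [hx35, div_lt_div_iff₀ (by norm_num) (by norm_num)]
    nlinarith [he27, show (90 : ℝ) < 2 ^ 42 by norm_num]
  · rw [hH]
    linarith [show (3000175332800 : ℝ) ≤ 2 ^ 42 by norm_num]

/-! ## (3.7) for a general zero-free-region constant -/

/-- **Johnston–Yang (3.7) with a general classical zero-free-region constant `R ∈ [4, R₀]`**
(PROVED modulo the named facts `JohnstonYang2023_lemma24` (Lemma 2.4), `platt_trudgian_numerical_rh`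
(Lemma 2.1) and `JohnstonYang2023_table3` (Lemma 2.6); the zero-free region
`ζ(σ + it) ≠ 0` for `|t| ≥ 2`, `σ ≥ 1 − 1/(R log|t|)` is the hypothesis `hZFR`; Brent–Platt–Trudgian's
Lemma 8 is the tree's theorem): for every row `(σ, C₁(σ), C₂(σ))` of Table 3, every `K ≥ 1` and
every `x ≥ e^{2488}`, with `T = exp(2√(log x/R))`, `H = 3 000 175 332 800`,
`|ψ(x) − x|/x ≤ s₁(x,σ;T) + s₂(x,σ,K;R) + s₃(x;T)`. The closed/open convention at `β = σ` is
immaterial (the bound at every `σ' ∈ (σ,1)`, then `σ' ↓ σ`, as in `JohnstonYang2023_eq37`).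
TODO(general form): the printed statement is the case `R = R₀ = 5.5666305`.
[cite: JohnstonYang2023, §3.2 eq. (3.7)] -/
theorem JohnstonYang2023_eq37_of_zfr (h24 : JohnstonYang2023_lemma24)
    (hRH : platt_trudgian_numerical_rh) (h3 : JohnstonYang2023_table3) {R : ℝ} (hR4 : 4 ≤ R)
    (hR : R ≤ JY2023.R₀)
    (hZFR : ∀ σ t : ℝ, 2 ≤ |t| → 1 - 1 / (R * Real.log |t|) ≤ σ → riemannZeta (σ + t * I) ≠ 0)
    {σ C₁ C₂ : ℝ} (hrow : (σ, C₁, C₂) ∈ JY2023.table3) {K : ℕ} (hK : 1 ≤ K) {x : ℝ}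
    (hx : Real.exp 2488 ≤ x) :
    |ψ x - x| / x ≤ JY2023.s₁ JY2023.H₀ x σ (JY2023.T R x)
      + JY2023.s₂ C₁ C₂ R x σ K + JY2023.s₃ x (JY2023.T R x) := by
  obtain ⟨hσ, hC₁, -⟩ := JY2023.table3_pos _ hrow
  have hσ1 : σ < 1 := JY2023.table3_lt_one _ hrow
  have hR0 : 0 < R := by linarith
  have hx1000 : Real.exp 1000 ≤ x := le_trans (Real.exp_le_exp.2 (by norm_num)) hx
  have hx0 : 0 < x := (Real.exp_pos _).trans_le hx1000
  obtain ⟨h50, hlog, h35, hHT⟩ := JY2023.lemma24_conditions_of_le_R₀ hR4 hR hx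
  set Tx := JY2023.T R x with hTx
  -- the bound at every σ' ∈ (σ, 1)
  have hσ' : ∀ σ' : ℝ, σ < σ' → σ' < 1 →
      |ψ x - x| / x ≤ JY2023.s₁ JY2023.H₀ x σ' Tx + JY2023.s₂ C₁ C₂ R x σ K + JY2023.s₃ x Tx := by
    intro σ' h1 h2
    exact JohnstonYang2023_eq37_of h24 BrentPlattTrudgian2022_lemma8_holds hRH hR0 hZFR (hσ.trans h1)
      h2 hC₁.le hσ1.le (fun u hu ↦ h3.of_one_le hRH hrow h1 hu) hK hx1000 h50 hlog h35 hHT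
  -- let σ' ↓ σ
  set a := x ^ (-(1 / 2 : ℝ)) * (Real.log (JY2023.H₀ / (2 * π)) ^ 2 / (2 * π)) with ha
  set c := Real.log (Tx / (2 * π)) ^ 2 / (2 * π) - Real.log (JY2023.H₀ / (2 * π)) ^ 2 / (2 * π) + 1.8642
    with hc
  set b := JY2023.s₂ C₁ C₂ R x σ K + JY2023.s₃ x Tx with hb
  have hs₁ : ∀ s : ℝ, JY2023.s₁ JY2023.H₀ x s Tx = a + x ^ (s - 1) * c := fun s ↦ rfl
  set g : ℝ → ℝ := fun s ↦ a + x ^ (s - 1) * c + b with hg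
  have hgcont : ContinuousAt g σ := by
    have h1 : ContinuousAt (fun s : ℝ ↦ x ^ (s - 1)) σ :=
      (Real.continuousAt_const_rpow hx0.ne').comp (continuousAt_id.sub continuousAt_const)
    exact (continuousAt_const.add (h1.mul continuousAt_const)).add continuousAt_const
  have htend : Tendsto g (𝓝[>] σ) (𝓝 (g σ)) := hgcont.continuousWithinAt.tendsto
  have hev : ∀ᶠ s in 𝓝[>] σ, |ψ x - x| / x ≤ g s := by
    have h1 : ∀ᶠ s in 𝓝[>] σ, s < 1 := eventually_nhdsWithin_of_eventually_nhds (Iio_mem_nhds hσ1)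
    have h2 : ∀ᶠ s in 𝓝[>] σ, σ < s := self_mem_nhdsWithin
    filter_upwards [h1, h2] with s hs1 hs2
    have := hσ' s hs2 hs1
    rw [hs₁] at this
    simpa only [hg, hb, add_assoc] using this
  have := ge_of_tendsto htend hev
  rw [hs₁]
  simpa only [hg, hb, add_assoc] using this

/-! ## The instance `R > 4.896` (Bellotti–Trudgian–Yang 2026, claimed) -/

/-- **JY (3.7) with any `R ∈ (4.896, R₀]`** from the CLAIMED zero-free region
`σ > 1 − 1/(4.896 log t)` (`t ≥ 3`) of Bellotti–Trudgian–Yang 2026 (preprint; the closed region with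
any `R > 4.896` and `|t| ≥ 2` is `zero_free_region_bellotti_trudgian_yang.zeroFree`): for every
Table-3 row, `K ≥ 1`, `x ≥ e^{2488}`, `|ψ(x) − x|/x ≤ s₁(x,σ;T) + s₂(x,σ,K;R) + s₃(x;T)`,
`T = exp(2√(log x/R))`. Named inputs: `JohnstonYang2023_lemma24`, `platt_trudgian_numerical_rh`,
`JohnstonYang2023_table3`, `zero_free_region_bellotti_trudgian_yang` (claim). TODO(general form):
the printed (3.7) has `R₀ = 5.5666305`.
[cite: JohnstonYang2023, §3.2 eq. (3.7)] [claim: BellottiTrudgianYang2026, status: under-review] -/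
theorem JohnstonYang2023_eq37_bty (h24 : JohnstonYang2023_lemma24) (hRH : platt_trudgian_numerical_rh)
    (h3 : JohnstonYang2023_table3) (hBTY : zero_free_region_bellotti_trudgian_yang) {R : ℝ}
    (hR : 4.896 < R) (hR' : R ≤ JY2023.R₀) {σ C₁ C₂ : ℝ} (hrow : (σ, C₁, C₂) ∈ JY2023.table3)
    {K : ℕ} (hK : 1 ≤ K) {x : ℝ} (hx : Real.exp 2488 ≤ x) :
    |ψ x - x| / x ≤ JY2023.s₁ JY2023.H₀ x σ (JY2023.T R x)
      + JY2023.s₂ C₁ C₂ R x σ K + JY2023.s₃ x (JY2023.T R x) :=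
  JohnstonYang2023_eq37_of_zfr h24 hRH h3 (by linarith) hR' (hBTY.zeroFree hR) hrow hK hx

/-! ## The same with the (ZDB) of FKS Cor. 2.9 -/

/-- **JY (3.7), general `R ∈ [4, R₀]`, with Fiori–Kadiri–Swidinsky's Cor. 2.9 densities** (PROVED
modulo `JohnstonYang2023_lemma24`, `platt_trudgian_numerical_rh`, `FioriKadiriSwidinsky2023_table6`;
zero-free region as hypothesis): for `0.90 ≤ σ < 1`, `K ≥ 1`, `x ≥ e^{2488}`,
`|ψ(x) − x|/x ≤ s₁(x,σ;T) + s₂(x,σ,K;R) + s₃(x;T)` with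
`N₀(σ,t) = c̃₁(σ)T^{8(1−σ)/3}log^{5−2σ}t + c̃₂(σ)log²t`, `T = exp(2√(log x/R))`.
TODO(general form): printed with `R₀` and Table 3.
[cite: JohnstonYang2023, §3.2 eq. (3.7)] [cite: FioriKadiriSwidinsky2023, Cor. 2.9] -/
theorem JohnstonYang2023_eq37_of_fks_table6_zfr (h24 : JohnstonYang2023_lemma24)
    (hRH : platt_trudgian_numerical_rh) (h6 : FioriKadiriSwidinsky2023_table6) {R : ℝ} (hR4 : 4 ≤ R)
    (hR : R ≤ JY2023.R₀)
    (hZFR : ∀ σ t : ℝ, 2 ≤ |t| → 1 - 1 / (R * Real.log |t|) ≤ σ → riemannZeta (σ + t * I) ≠ 0)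
    {σ : ℝ} (h9 : 0.90 ≤ σ) (hσ1 : σ < 1) {K : ℕ} (hK : 1 ≤ K) {x : ℝ} (hx : Real.exp 2488 ≤ x) :
    |ψ x - x| / x ≤ JY2023.s₁ JY2023.H₀ x σ (JY2023.T R x)
      + JY2023.s₂ (FKS2023.table6c₁ σ) (FKS2023.table6c₂ σ) R x σ K
      + JY2023.s₃ x (JY2023.T R x) := by
  have hσ : 1 / 2 < σ := by norm_num at h9; linarith
  have hR0 : 0 < R := by linarith
  have hx1000 : Real.exp 1000 ≤ x := le_trans (Real.exp_le_exp.2 (by norm_num)) hx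
  obtain ⟨h50, hlog, h35, hHT⟩ := JY2023.lemma24_conditions_of_le_R₀ hR4 hR hx
  exact JohnstonYang2023_eq37_of h24 BrentPlattTrudgian2022_lemma8_holds hRH hR0 hZFR hσ hσ1
    (FKS2023.table6c_nonneg σ).1 hσ1.le
    (fun u hu ↦ FKS2023.table6_inghamBound_of_one_le h6 hRH h9 hσ1.le hu) hK hx1000 h50 hlog h35 hHT

/-- The instance `R ∈ (4.896, R₀]` of the previous theorem from the claimed Bellotti–Trudgian–Yang
region. [cite: JohnstonYang2023, §3.2 eq. (3.7)] [cite: FioriKadiriSwidinsky2023, Cor. 2.9]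
[claim: BellottiTrudgianYang2026, status: under-review] -/
theorem JohnstonYang2023_eq37_of_fks_table6_bty (h24 : JohnstonYang2023_lemma24)
    (hRH : platt_trudgian_numerical_rh) (h6 : FioriKadiriSwidinsky2023_table6)
    (hBTY : zero_free_region_bellotti_trudgian_yang) {R : ℝ} (hR : 4.896 < R) (hR' : R ≤ JY2023.R₀)
    {σ : ℝ} (h9 : 0.90 ≤ σ) (hσ1 : σ < 1) {K : ℕ} (hK : 1 ≤ K) {x : ℝ} (hx : Real.exp 2488 ≤ x) :
    |ψ x - x| / x ≤ JY2023.s₁ JY2023.H₀ x σ (JY2023.T R x)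
      + JY2023.s₂ (FKS2023.table6c₁ σ) (FKS2023.table6c₂ σ) R x σ K
      + JY2023.s₃ x (JY2023.T R x) :=
  JohnstonYang2023_eq37_of_fks_table6_zfr h24 hRH h6 (by linarith) hR' (hBTY.zeroFree hR) h9 hσ1 hK hx

/-! ## Monotonicity of the truncation height in `R` -/

/-- `R ↦ T(R, x) = exp(2√(log x/R))` is non-increasing on `(0, ∞)` for `x ≥ 1`: a smaller
zero-free-region constant gives a LARGER truncation height (so a smaller `s₃ = 4.3128 log^{0.6}x/T`).
[cite: JohnstonYang2023, §3.2 (before eq. (3.1))] -/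
theorem JY2023.T_anti {R R' x : ℝ} (hR : 0 < R) (hRR' : R ≤ R') (hx : 1 ≤ x) :
    JY2023.T R' x ≤ JY2023.T R x := by
  unfold JY2023.T
  refine Real.exp_le_exp.2 (mul_le_mul_of_nonneg_left (Real.sqrt_le_sqrt ?_) (by norm_num))
  exact div_le_div_of_nonneg_left (Real.log_nonneg hx) hR hRR'

/-- Hence `s₃(x; T(R,x)) ≤ s₃(x; T(R',x))` for `0 < R ≤ R'`, `x ≥ 1`. [cite: JohnstonYang2023, §3.2 eq. (3.8)] -/
theorem JY2023.s₃_mono_R {R R' x : ℝ} (hR : 0 < R) (hRR' : R ≤ R') (hx : 1 ≤ x) :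
    JY2023.s₃ x (JY2023.T R x) ≤ JY2023.s₃ x (JY2023.T R' x) := by
  unfold JY2023.s₃
  have hT := JY2023.T_anti hR hRR' hx
  have hT0 : 0 < JY2023.T R' x := Real.exp_pos _
  have hlog : 0 ≤ Real.log x ^ (0.6 : ℝ) := Real.rpow_nonneg (Real.log_nonneg hx) _
  refine mul_le_mul_of_nonneg_right ?_ hlog
  exact div_le_div_of_nonneg_left (by norm_num) hT0 hT

end Literature.NumberTheory.LFunctions

end
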